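import Summits.Ventures.Crystal3D.Theorems.StickyWulffConstantGenericWallFloorStackWalkFrames
import Summits.Ventures.Crystal3D.Theorems.StickyWulffConstantGenericWallFloorExitWindow
import HarnessLib

/-!
# Sealed samples carry no foreign walker states: ANY certified state deep in a clamped sample has the sample's
# lattice on top, and no sealed sample ball is an exact oriented cap
# (crux `GenericWallFloor`, stmt-Ventures-19480, line `WallLedgerG`; memo RISER-LEDGER-g8 §4 (a), HOME/wall-p1-g8/)

HONEST FRAMING. Venture `Summits/Ventures/Crystal3D` (cell `crystal3d-full`), helper `--supports` the crux
`GenericWallFloor` of `route-Ventures-StickyWulffConstant`, REGISTERED line `WallLedgerG`, open stub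
`stub_twoSlabAdhesion`.  Structure only (census-free); F-C1 not moved; NOT the crux, no ledger here.

WHY.  The one-sided ledgers of record (`…StackLedgerOneSided{,Tilt,Wide}`) keep the steering `z` within `1/3` of the
vertical and control the walkers through HEIGHT monotonicity: a walker never returns to its start slab and its lateral
drift is `≤ (8/3)·rise`.  The SWEPT steering of memo RISER-LEDGER-g8 (tilt ≈ 40°, `…SweptSteering{,Exists}`) has no height
monotonicity, so its ledger must control walkers by WHERE THEY CAN STAND instead.  `…StackWalkFrames` proved the end-ball
versions (`stackWalk_end_not_high/_low`); this file states the facts for EVERY state of a walk, which is what the swept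
ledger's sealing (no traversal of the far sample) and injectivity (no re-entry into the own sample) arguments consume:

* **`frame_image_eq_of_walkInv_high`** / **`frame_image_eq_of_walkInv_low`** — a state satisfying `WalkInv` (any steering
  `z`) whose ball lies off the rim (`x² + y² ≤ (ρ − 2)²`) at height `≥ h + R₀ + 2` (resp. `≤ −R₀ − 2`) has a TOP FRAME whose
  linear lattice is the top (resp. bottom) grain's: `e.frame '' Λ₀ = A₂ '' Λ₀` (resp. `= A₁ '' Λ₀`).  (Certified walker ⇒
  three independent exact top-frame neighbours, `walkCertified_three_independent`; sealing ⇒ they are lattice balls,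
  `movedFcc_eq_of_exact_neighbours_high/_low`.)  Consequences for a swept walker whose ray avoids the far lattice
  (`hfar`): it is NEVER positioned deep in the far sample, at any time, whatever its path — not only at its end; and a
  walker positioned deep in its OWN sample carries its bottom grain's lattice on top (with the twin tree: the bottom
  entry itself).
* **`not_isOrientedCap_of_sealed`** — a ball `c` of the complete sample `P` of `Λ = A·Λ₀ + t` in `[a, b] × disc ρ`, sealed
  (`a + 1 ≤ c₂ ≤ b − 1`, `c₀² + c₁² ≤ (ρ − 2)²`, `X` `1`-separated, `P ⊆ X`), is an exact oriented cap of NO frame: the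
  occupied negative slot `c − F v` is a sealed ball, hence a lattice ball, hence `c + F v = c + (c − (c − F v))` is a
  lattice ball of the window, hence present — but a cap's positive slot `c + F v` is empty.  So no PUSH and no POP ever
  happens at a sealed sample ball (`walkStep` there is FULL or STOP), for any steering.
* `twin_negative_slot_not_mem_image`, **`not_twinCap_of_floor_sample`** / `…_of_ceiling_sample` (appended): a genuine twin
  frame has NO exact cap at ANY lattice ball of the bottom (top) sample off the rim, without a depth margin — its negative slots
  would be occupied off-lattice positions inside the sealed window (floor/ceiling of the cell closes the window from below/above).
  This is the POP exclusion along the whole backward line of the arbitrary-steering injectivity argument.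
WHAT THIS IS NOT: no ledger; the twin-tree step («non-bottom ray frames never carry the bottom lattice») is not here;
F-C1 not moved.
-/

noncomputable section

namespace Summit.Ventures.Crystal3D.Theorems

open Finset
open Literature.MathematicalPhysics.StatisticalMechanics (fccStacking)
open scoped InnerProductSpace

variable {X : Finset (EuclideanSpace ℝ (Fin 3))}

/-! ### Any certified state deep in a sample carries that sample's lattice on top -/

/-- **High states carry the top grain's lattice.**  `WalkInv X z s` (any unit `z`), the ball `s.1` off the rim at height
`≥ h + R₀ + 2` inside the cell of the clamped top sample `P₂` of `A₂·Λ₀ + t₂`: the top entry `e` of the stack has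
`e.frame '' Λ₀ = A₂ '' Λ₀`. -/
theorem frame_image_eq_of_walkInv_high
    (hX : ∀ p ∈ X, ∀ q ∈ X, p ≠ q → 1 ≤ dist p q)
    (A₂ : EuclideanSpace ℝ (Fin 3) ≃ₗᵢ[ℝ] EuclideanSpace ℝ (Fin 3)) (t₂ : EuclideanSpace ℝ (Fin 3))
    (P₂ : Finset (EuclideanSpace ℝ (Fin 3))) (R₀ h ρ : ℝ) (hρ2 : 2 ≤ ρ) (hP₂X : P₂ ⊆ X)
    (hcell : ∀ p ∈ X, p 2 ≤ h + 2 * R₀)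
    (hP₂ : ∀ p, p ∈ P₂ ↔ (p ∈ (fun q => A₂ q + t₂) '' fccStacking 1 (Real.sqrt (2 / 3)) ∧
      h + R₀ ≤ p 2 ∧ p 2 ≤ h + 2 * R₀ ∧ p 0 ^ 2 + p 1 ^ 2 ≤ ρ ^ 2))
    {z : EuclideanSpace ℝ (Fin 3)} {s : EuclideanSpace ℝ (Fin 3) × List WalkEntry} (hInv : WalkInv X z s)
    {e : WalkEntry} {rest : List WalkEntry} (hstk : s.2 = e :: rest)
    (hy2 : h + R₀ + 2 ≤ s.1 2) (hyr : s.1 0 ^ 2 + s.1 1 ^ 2 ≤ (ρ - 2) ^ 2) :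
    e.frame '' fccStacking 1 (Real.sqrt (2 / 3)) = A₂ '' fccStacking 1 (Real.sqrt (2 / 3)) := by
  obtain ⟨hyX, hS, e', rest', hstk', hC⟩ := hInv
  rw [hstk] at hstk' hS
  obtain ⟨rfl, rfl⟩ : e = e' ∧ rest = rest' := by
    injection hstk' with h1 h2; exact ⟨h1, h2⟩
  obtain ⟨a, ha, b, hb, c, hc, hind, haX, hbX, hcX⟩ := walkCertified_three_independent (hS.top).1 hC
  exact movedFcc_eq_of_exact_neighbours_high A₂ t₂ X P₂ R₀ h ρ hρ2 hX hP₂X hcell hP₂ e.frame hyX hy2 hyr ha hb hc hind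
    haX hbX hcX

/-- **Low states carry the bottom grain's lattice.**  Same, for the clamped bottom sample `P₁` of `A₁·Λ₀ + t₁` and a
state at height `≤ −R₀ − 2` off the rim. -/
theorem frame_image_eq_of_walkInv_low
    (hX : ∀ p ∈ X, ∀ q ∈ X, p ≠ q → 1 ≤ dist p q)
    (A₁ : EuclideanSpace ℝ (Fin 3) ≃ₗᵢ[ℝ] EuclideanSpace ℝ (Fin 3)) (t₁ : EuclideanSpace ℝ (Fin 3))
    (P₁ : Finset (EuclideanSpace ℝ (Fin 3))) (R₀ ρ : ℝ) (hρ2 : 2 ≤ ρ) (hP₁X : P₁ ⊆ X)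
    (hcell : ∀ p ∈ X, -(2 * R₀) ≤ p 2)
    (hP₁ : ∀ p, p ∈ P₁ ↔ (p ∈ (fun q => A₁ q + t₁) '' fccStacking 1 (Real.sqrt (2 / 3)) ∧
      -(2 * R₀) ≤ p 2 ∧ p 2 ≤ -R₀ ∧ p 0 ^ 2 + p 1 ^ 2 ≤ ρ ^ 2))
    {z : EuclideanSpace ℝ (Fin 3)} {s : EuclideanSpace ℝ (Fin 3) × List WalkEntry} (hInv : WalkInv X z s)
    {e : WalkEntry} {rest : List WalkEntry} (hstk : s.2 = e :: rest)
    (hy2 : s.1 2 ≤ -R₀ - 2) (hyr : s.1 0 ^ 2 + s.1 1 ^ 2 ≤ (ρ - 2) ^ 2) :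
    e.frame '' fccStacking 1 (Real.sqrt (2 / 3)) = A₁ '' fccStacking 1 (Real.sqrt (2 / 3)) := by
  obtain ⟨hyX, hS, e', rest', hstk', hC⟩ := hInv
  rw [hstk] at hstk' hS
  obtain ⟨rfl, rfl⟩ : e = e' ∧ rest = rest' := by
    injection hstk' with h1 h2; exact ⟨h1, h2⟩
  obtain ⟨a, ha, b, hb, c, hc, hind, haX, hbX, hcX⟩ := walkCertified_three_independent (hS.top).1 hC
  exact movedFcc_eq_of_exact_neighbours_low A₁ t₁ X P₁ R₀ ρ hρ2 hX hP₁X hcell hP₁ e.frame hyX hy2 hyr ha hb hc hind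
    haX hbX hcX

/-- **A walker of a family whose stack frames avoid the far lattice is never deep in the far sample** (any steering,
any time): if every entry of the stack has `frame '' Λ₀ ≠ A₂ '' Λ₀`, a state satisfying `WalkInv` off the rim lies strictly
below height `h + R₀ + 2`. -/
theorem walkInv_not_high_of_frames_avoid
    (hX : ∀ p ∈ X, ∀ q ∈ X, p ≠ q → 1 ≤ dist p q)
    (A₂ : EuclideanSpace ℝ (Fin 3) ≃ₗᵢ[ℝ] EuclideanSpace ℝ (Fin 3)) (t₂ : EuclideanSpace ℝ (Fin 3))
    (P₂ : Finset (EuclideanSpace ℝ (Fin 3))) (R₀ h ρ : ℝ) (hρ2 : 2 ≤ ρ) (hP₂X : P₂ ⊆ X)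
    (hcell : ∀ p ∈ X, p 2 ≤ h + 2 * R₀)
    (hP₂ : ∀ p, p ∈ P₂ ↔ (p ∈ (fun q => A₂ q + t₂) '' fccStacking 1 (Real.sqrt (2 / 3)) ∧
      h + R₀ ≤ p 2 ∧ p 2 ≤ h + 2 * R₀ ∧ p 0 ^ 2 + p 1 ^ 2 ≤ ρ ^ 2))
    {z : EuclideanSpace ℝ (Fin 3)} {s : EuclideanSpace ℝ (Fin 3) × List WalkEntry} (hInv : WalkInv X z s)
    (havoid : ∀ e ∈ s.2, e.frame '' fccStacking 1 (Real.sqrt (2 / 3)) ≠ A₂ '' fccStacking 1 (Real.sqrt (2 / 3)))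
    (hyr : s.1 0 ^ 2 + s.1 1 ^ 2 ≤ (ρ - 2) ^ 2) : s.1 2 < h + R₀ + 2 := by
  by_contra hhigh
  push Not at hhigh
  obtain ⟨e, rest, hstk, -⟩ := hInv.2.2
  exact havoid e (by rw [hstk]; simp)
    (frame_image_eq_of_walkInv_high hX A₂ t₂ P₂ R₀ h ρ hρ2 hP₂X hcell hP₂ hInv hstk hhigh hyr)

/-- **…and never deep in its own sample unless it carries the bottom lattice on top**: if every entry has
`frame '' Λ₀ ≠ A₁ '' Λ₀` except possibly entries whose frame image IS `A₁ '' Λ₀`, then at a state off the rim at height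
`≤ −R₀ − 2` the top frame's lattice is `A₁ '' Λ₀` (restated for the bottom sample: the contrapositive form used by the
injectivity argument — a non-bottom ray frame can never stand there). -/
theorem walkInv_not_low_of_frames_avoid
    (hX : ∀ p ∈ X, ∀ q ∈ X, p ≠ q → 1 ≤ dist p q)
    (A₁ : EuclideanSpace ℝ (Fin 3) ≃ₗᵢ[ℝ] EuclideanSpace ℝ (Fin 3)) (t₁ : EuclideanSpace ℝ (Fin 3))
    (P₁ : Finset (EuclideanSpace ℝ (Fin 3))) (R₀ ρ : ℝ) (hρ2 : 2 ≤ ρ) (hP₁X : P₁ ⊆ X)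
    (hcell : ∀ p ∈ X, -(2 * R₀) ≤ p 2)
    (hP₁ : ∀ p, p ∈ P₁ ↔ (p ∈ (fun q => A₁ q + t₁) '' fccStacking 1 (Real.sqrt (2 / 3)) ∧
      -(2 * R₀) ≤ p 2 ∧ p 2 ≤ -R₀ ∧ p 0 ^ 2 + p 1 ^ 2 ≤ ρ ^ 2))
    {z : EuclideanSpace ℝ (Fin 3)} {s : EuclideanSpace ℝ (Fin 3) × List WalkEntry} (hInv : WalkInv X z s)
    {e : WalkEntry} {rest : List WalkEntry} (hstk : s.2 = e :: rest)
    (havoid : e.frame '' fccStacking 1 (Real.sqrt (2 / 3)) ≠ A₁ '' fccStacking 1 (Real.sqrt (2 / 3)))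
    (hyr : s.1 0 ^ 2 + s.1 1 ^ 2 ≤ (ρ - 2) ^ 2) : -R₀ - 2 < s.1 2 := by
  by_contra hlow
  push Not at hlow
  exact havoid (frame_image_eq_of_walkInv_low hX A₁ t₁ P₁ R₀ ρ hρ2 hP₁X hcell hP₁ hInv hstk hlow hyr)

/-! ### No exact oriented cap at a sealed sample ball -/

/-- **A sealed ball of a complete sample is an exact oriented cap of NO frame.**  `P ⊆ X` the complete sample of
`Λ = A·Λ₀ + t` in `[a, b] × disc ρ` (`X` `1`-separated, `ρ ≥ 2`), `c ∈ X` with `a + 1 ≤ c₂ ≤ b − 1` and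
`c₀² + c₁² ≤ (ρ − 2)²`.  Then `¬ IsOrientedCap X F c v n` for every frame `F`, direction `v` and normal `n`: the negative
slot `c − F v` is occupied (cap) and sealed, hence a lattice ball; so `c + F v` is a lattice ball of the window, hence
occupied — contradicting the emptiness of the cap's positive slot `c + F v`. -/
theorem not_isOrientedCap_of_sealed
    (hX : ∀ p ∈ X, ∀ q ∈ X, p ≠ q → 1 ≤ dist p q)
    (A : EuclideanSpace ℝ (Fin 3) ≃ₗᵢ[ℝ] EuclideanSpace ℝ (Fin 3)) (t : EuclideanSpace ℝ (Fin 3))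
    (P : Finset (EuclideanSpace ℝ (Fin 3))) (a b ρ : ℝ) (hρ2 : 2 ≤ ρ) (hPX : P ⊆ X)
    (hP : ∀ p, p ∈ P ↔ (p ∈ (fun q => A q + t) '' fccStacking 1 (Real.sqrt (2 / 3)) ∧
      a ≤ p 2 ∧ p 2 ≤ b ∧ p 0 ^ 2 + p 1 ^ 2 ≤ ρ ^ 2))
    {c : EuclideanSpace ℝ (Fin 3)} (hcX : c ∈ X) (hca : a + 1 ≤ c 2) (hcb : c 2 ≤ b - 1)
    (hcr : c 0 ^ 2 + c 1 ^ 2 ≤ (ρ - 2) ^ 2)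
    (F : EuclideanSpace ℝ (Fin 3) ≃ₗᵢ[ℝ] EuclideanSpace ℝ (Fin 3)) (v n : EuclideanSpace ℝ (Fin 3))
    (hv : v ∈ fccSlots) : ¬ IsOrientedCap X F c v n := by
  rintro ⟨hn, hmenu, hvn, hle, hgt⟩
  have hρ1 : (1 : ℝ) ≤ ρ := by linarith
  have hρ2' : (0 : ℝ) ≤ ρ - 2 := by linarith
  have hab : a + 2 ≤ b := by linarith
  have hr : 0 < Real.sqrt (2 / 3) := Real.sqrt_pos.2 (by norm_num)
  have hFv : ‖F v‖ = 1 := by rw [LinearIsometryEquiv.norm_map, norm_eq_one_of_mem_fccSlots hv]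
  -- sealing: balls within `1` of `c` lie in the window, off the rim by `1`
  have hseal : ∀ q ∈ X, dist q c ≤ 1 → q ∈ (fun s => A s + t) '' fccStacking 1 (Real.sqrt (2 / 3)) := by
    intro q hq hd
    have h1 := abs_apply_sub_le_dist q c 2
    have h2 := abs_le.1 (h1.trans hd)
    have hlat : q 0 ^ 2 + q 1 ^ 2 ≤ (ρ - 2 + 1) ^ 2 := lateral_sq_le_of_dist_le_one hρ2' hcr hd
    have hqP := mem_sample_of_sealed A t a b ρ hρ1 hab hX hPX hP hq (by linarith [h2.1]) (by linarith [h2.2])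
      (by convert hlat using 2; ring)
    exact ((hP q).1 hqP).1
  have hcΛ : c ∈ (fun s => A s + t) '' fccStacking 1 (Real.sqrt (2 / 3)) := hseal c hcX (by rw [dist_self]; exact zero_le_one)
  -- the negative slot `−v` is occupied: `c − F v ∈ X`, a lattice ball
  have hnegv : -v ∈ fccSlots := neg_mem_fccSlots hv
  have hneg : ⟪F (-v), n⟫_ℝ ≤ 0 := by rw [map_neg, inner_neg_left, hvn]; linarith
  have hqX : c + F (-v) ∈ X := hle (-v) hnegv hneg
  have hqX' : c - F v ∈ X := by rw [map_neg, ← sub_eq_add_neg] at hqX; exact hqX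
  have hqΛ : c - F v ∈ (fun s => A s + t) '' fccStacking 1 (Real.sqrt (2 / 3)) :=
    hseal _ hqX' (by rw [dist_eq_norm, sub_sub_cancel_left, norm_neg, hFv])
  -- hence `F v` is a lattice vector and `c + F v` a lattice ball of the window
  have hFvΛ : F v ∈ A '' fccStacking 1 (Real.sqrt (2 / 3)) := by
    have := sub_mem_image_of_mem_affine A t c (c - F v) hcΛ hqΛ
    rwa [sub_sub_cancel] at this
  obtain ⟨s₁, hs₁, hcs⟩ := hcΛ
  obtain ⟨w₁, hw₁, hFw⟩ := hFvΛ
  have hplus : c + F v ∈ (fun s => A s + t) '' fccStacking 1 (Real.sqrt (2 / 3)) := by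
    refine ⟨s₁ + w₁, fcc_add_site_mem hs₁ hw₁, ?_⟩
    simp only at hcs ⊢
    rw [map_add, ← hcs, ← hFw]; abel
  have hplusP : c + F v ∈ P := by
    refine (hP _).2 ⟨hplus, ?_, ?_, ?_⟩
    · have h1 := abs_apply_sub_le_dist (c + F v) c 2
      rw [dist_eq_norm, add_sub_cancel_left, hFv] at h1
      linarith [(abs_le.1 h1).1]
    · have h1 := abs_apply_sub_le_dist (c + F v) c 2
      rw [dist_eq_norm, add_sub_cancel_left, hFv] at h1
      linarith [(abs_le.1 h1).2]
    · have := lateral_sq_add_le c (F v) hρ2' hcr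
      rw [hFv] at this
      have h3 : (ρ - 2 + 1) ^ 2 ≤ ρ ^ 2 := by nlinarith
      exact this.trans h3
  -- but the positive slot `c + F v` of a cap is empty
  have hpos : 0 < ⟪F v, n⟫_ℝ := by rw [hvn]; exact hr
  exact (hgt v hv hpos).1 (hPX hplusP)

/-- **Hence at a sealed sample ball the walk never PUSHes or POPs**: with top entry `e` (direction a slot), either the
ball is `e.frame`-full (the step is FULL) or `walkStep` stops. -/
theorem walkStep_at_sealed
    (hX : ∀ p ∈ X, ∀ q ∈ X, p ≠ q → 1 ≤ dist p q)
    (A : EuclideanSpace ℝ (Fin 3) ≃ₗᵢ[ℝ] EuclideanSpace ℝ (Fin 3)) (t : EuclideanSpace ℝ (Fin 3))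
    (P : Finset (EuclideanSpace ℝ (Fin 3))) (a b ρ : ℝ) (hρ2 : 2 ≤ ρ) (hPX : P ⊆ X)
    (hP : ∀ p, p ∈ P ↔ (p ∈ (fun q => A q + t) '' fccStacking 1 (Real.sqrt (2 / 3)) ∧
      a ≤ p 2 ∧ p 2 ≤ b ∧ p 0 ^ 2 + p 1 ^ 2 ≤ ρ ^ 2))
    {c : EuclideanSpace ℝ (Fin 3)} (hcX : c ∈ X) (hca : a + 1 ≤ c 2) (hcb : c 2 ≤ b - 1)
    (hcr : c 0 ^ 2 + c 1 ^ 2 ≤ (ρ - 2) ^ 2) (z : EuclideanSpace ℝ (Fin 3)) (e : WalkEntry) (rest : List WalkEntry)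
    (hdir : e.dir ∈ fccSlots) :
    walkStep X z (c, e :: rest) = some (c + e.frame e.dir, e :: rest) ∨ walkStep X z (c, e :: rest) = none := by
  classical
  by_cases hfull : ∀ w ∈ fccSlots, c + e.frame w ∈ X
  · exact Or.inl (walkStep_of_full X z c e rest hfull)
  · refine Or.inr (walkStep_of_stop X z c e rest hfull ?_)
    rintro ⟨n, hcap⟩
    exact not_isOrientedCap_of_sealed hX A t P a b ρ hρ2 hPX hP hcX hca hcb hcr e.frame e.dir n hdir hcap

/-! ### No TWIN cap at any floor-side sample ball (no depth margin): the negative slots would be off-lattice balls -/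

/-- A negative slot vector of a twin frame is not a lattice vector: if `F x = A x − 2⟪A x, n⟫ n` (unit `n`) and `w` is a
slot with `⟪F w, n⟫ = −√(2/3)`, then `F w ∉ A '' Λ₀` (two unit lattice vectors would differ by `2√(2/3) n`, of norm² `8/3`,
but slots meet at inner products in `{1, ½, 0, −½, −1}`). -/
theorem twin_negative_slot_not_mem_image (A F : EuclideanSpace ℝ (Fin 3) ≃ₗᵢ[ℝ] EuclideanSpace ℝ (Fin 3))
    {n w : EuclideanSpace ℝ (Fin 3)} (hn : ‖n‖ = 1) (hF : ∀ x, F x = A x - (2 * ⟪A x, n⟫_ℝ) • n)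
    (hw : w ∈ fccSlots) (hwn : ⟪F w, n⟫_ℝ = -Real.sqrt (2 / 3)) :
    F w ∉ A '' fccStacking 1 (Real.sqrt (2 / 3)) := by
  rintro ⟨x, hx, hxw⟩
  have hFw : ‖F w‖ = 1 := by rw [LinearIsometryEquiv.norm_map, norm_eq_one_of_mem_fccSlots hw]
  have hx1 : ‖x‖ = 1 := by rw [← A.norm_map x, hxw, hFw]
  have hxs : x ∈ fccSlots := mem_fccSlots_of_unit hx hx1
  -- `⟪A w, n⟫ = +√(2/3)` and `F w = A w − 2√(2/3) n`
  have hflip := inner_twin_eq_neg A F hn hF w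
  have hAwn : ⟪A w, n⟫_ℝ = Real.sqrt (2 / 3) := by linarith
  have hAx : A x = A w - (2 * Real.sqrt (2 / 3)) • n := by rw [hxw, hF w, hAwn]
  -- inner product `⟪x, w⟫ = ⟪A x, A w⟫ = 1 − 2·(2/3) = −1/3`, impossible for two slots
  have h23 : Real.sqrt (2 / 3) * Real.sqrt (2 / 3) = 2 / 3 := Real.mul_self_sqrt (by norm_num)
  have hww : ⟪A w, A w⟫_ℝ = 1 := by
    rw [real_inner_self_eq_norm_sq, LinearIsometryEquiv.norm_map, norm_eq_one_of_mem_fccSlots hw, one_pow]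
  have hxwi : ⟪x, w⟫_ℝ = -(1 / 3) := by
    rw [← A.inner_map_map x w, hAx, inner_sub_left, real_inner_smul_left, real_inner_comm (A w) n, hAwn, hww]
    nlinarith [h23]
  rcases inner_slots_mem hxs hw with h | h | h | h | h <;> rw [hxwi] at h <;> norm_num at h

/-- **No twin cap at a floor-side sample ball.**  `P ⊆ X` the complete sample of `Λ = A·Λ₀ + t` in `[a, b] × disc ρ`, where
`a` is the FLOOR of the configuration (`∀ q ∈ X, a ≤ q₂`); `c ∈ Λ ∩ X` with `c₂ ≤ b − 1` and `c₀² + c₁² ≤ (ρ − 2)²` (no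
lower margin).  Then `c` is an exact oriented cap of NO genuine twin frame `F x = A x − 2⟪A x, n⟫ n` with cap normal `n`:
a cap needs its `n`-negative `F`-slots occupied, those positions are NOT lattice points (previous lemma), yet any ball there
lies in the sealed window (height `≥ a` by the floor, `≤ c₂ + 1 ≤ b`, radius `≤ ρ − 1`), hence is a lattice ball.  This is
the POP-exclusion the arbitrary-steering injectivity argument needs at every ball of the backward line down to the floor. -/
theorem not_twinCap_of_floor_sample
    (hX : ∀ p ∈ X, ∀ q ∈ X, p ≠ q → 1 ≤ dist p q)
    (A : EuclideanSpace ℝ (Fin 3) ≃ₗᵢ[ℝ] EuclideanSpace ℝ (Fin 3)) (t : EuclideanSpace ℝ (Fin 3))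
    (P : Finset (EuclideanSpace ℝ (Fin 3))) (a b ρ : ℝ) (hρ2 : 2 ≤ ρ) (hab : a + 2 ≤ b) (hPX : P ⊆ X)
    (hP : ∀ p, p ∈ P ↔ (p ∈ (fun q => A q + t) '' fccStacking 1 (Real.sqrt (2 / 3)) ∧
      a ≤ p 2 ∧ p 2 ≤ b ∧ p 0 ^ 2 + p 1 ^ 2 ≤ ρ ^ 2))
    (hfloor : ∀ q ∈ X, a ≤ q 2)
    {c : EuclideanSpace ℝ (Fin 3)} (hcΛ : c ∈ (fun q => A q + t) '' fccStacking 1 (Real.sqrt (2 / 3)))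
    (hcb : c 2 ≤ b - 1) (hcr : c 0 ^ 2 + c 1 ^ 2 ≤ (ρ - 2) ^ 2)
    (F : EuclideanSpace ℝ (Fin 3) ≃ₗᵢ[ℝ] EuclideanSpace ℝ (Fin 3)) {n : EuclideanSpace ℝ (Fin 3)} (hn : ‖n‖ = 1)
    (hmenu : ∀ w ∈ fccSlots, ⟪A w, n⟫_ℝ = 0 ∨ ⟪A w, n⟫_ℝ = Real.sqrt (2 / 3) ∨ ⟪A w, n⟫_ℝ = -Real.sqrt (2 / 3))
    (hF : ∀ x, F x = A x - (2 * ⟪A x, n⟫_ℝ) • n) (v : EuclideanSpace ℝ (Fin 3)) :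
    ¬ IsOrientedCap X F c v n := by
  rintro ⟨-, -, -, hle, -⟩
  have hρ1 : (1 : ℝ) ≤ ρ := by linarith
  have hρ2' : (0 : ℝ) ≤ ρ - 2 := by linarith
  -- a negative `F`-slot: take a positive `A`-slot `w₁` of `n` and use `w₁` as an `F`-slot (`⟪F w₁, n⟫ = −√(2/3)`)
  obtain ⟨w₁, hw₁, w₂, -, w₃, -, -, -, -, hn1, -, -⟩ := exists_three_far_slots A hn hmenu
  have hflip := inner_twin_eq_neg A F hn hF w₁
  have hneg : ⟪F w₁, n⟫_ℝ = -Real.sqrt (2 / 3) := by rw [hflip, hn1]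
  have hr : 0 < Real.sqrt (2 / 3) := Real.sqrt_pos.2 (by norm_num)
  have hocc : c + F w₁ ∈ X := hle w₁ hw₁ (by rw [hneg]; linarith)
  -- that ball is sealed, hence a lattice ball
  have hFw : ‖F w₁‖ = 1 := by rw [LinearIsometryEquiv.norm_map, norm_eq_one_of_mem_fccSlots hw₁]
  have hq2 : (c + F w₁) 2 ≤ b := by
    have h1 := abs_apply_sub_le_dist (c + F w₁) c 2
    rw [dist_eq_norm, add_sub_cancel_left, hFw] at h1
    linarith [(abs_le.1 h1).2]
  have hqr : (c + F w₁) 0 ^ 2 + (c + F w₁) 1 ^ 2 ≤ (ρ - 1) ^ 2 := by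
    have := lateral_sq_add_le c (F w₁) hρ2' hcr
    rw [hFw] at this
    convert this using 2; ring
  have hqP := mem_sample_of_sealed A t a b ρ hρ1 hab hX hPX hP hocc (hfloor _ hocc) hq2 hqr
  have hqΛ := ((hP _).1 hqP).1
  -- so `F w₁ = (c + F w₁) − c` is a lattice vector: contradiction
  have hFwΛ : F w₁ ∈ A '' fccStacking 1 (Real.sqrt (2 / 3)) := by
    have := sub_mem_image_of_mem_affine A t (c + F w₁) c hqΛ hcΛ
    rwa [add_sub_cancel_left] at this
  exact twin_negative_slot_not_mem_image A F hn hF hw₁ hneg hFwΛ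

/-- **Mirror statement for the top sample (ceiling side).**  Same with the CEILING `b` of the configuration
(`∀ q ∈ X, q₂ ≤ b`) and `c₂ ≥ a + 1`. -/
theorem not_twinCap_of_ceiling_sample
    (hX : ∀ p ∈ X, ∀ q ∈ X, p ≠ q → 1 ≤ dist p q)
    (A : EuclideanSpace ℝ (Fin 3) ≃ₗᵢ[ℝ] EuclideanSpace ℝ (Fin 3)) (t : EuclideanSpace ℝ (Fin 3))
    (P : Finset (EuclideanSpace ℝ (Fin 3))) (a b ρ : ℝ) (hρ2 : 2 ≤ ρ) (hab : a + 2 ≤ b) (hPX : P ⊆ X)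
    (hP : ∀ p, p ∈ P ↔ (p ∈ (fun q => A q + t) '' fccStacking 1 (Real.sqrt (2 / 3)) ∧
      a ≤ p 2 ∧ p 2 ≤ b ∧ p 0 ^ 2 + p 1 ^ 2 ≤ ρ ^ 2))
    (hceil : ∀ q ∈ X, q 2 ≤ b)
    {c : EuclideanSpace ℝ (Fin 3)} (hcΛ : c ∈ (fun q => A q + t) '' fccStacking 1 (Real.sqrt (2 / 3)))
    (hca : a + 1 ≤ c 2) (hcr : c 0 ^ 2 + c 1 ^ 2 ≤ (ρ - 2) ^ 2)
    (F : EuclideanSpace ℝ (Fin 3) ≃ₗᵢ[ℝ] EuclideanSpace ℝ (Fin 3)) {n : EuclideanSpace ℝ (Fin 3)} (hn : ‖n‖ = 1)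
    (hmenu : ∀ w ∈ fccSlots, ⟪A w, n⟫_ℝ = 0 ∨ ⟪A w, n⟫_ℝ = Real.sqrt (2 / 3) ∨ ⟪A w, n⟫_ℝ = -Real.sqrt (2 / 3))
    (hF : ∀ x, F x = A x - (2 * ⟪A x, n⟫_ℝ) • n) (v : EuclideanSpace ℝ (Fin 3)) :
    ¬ IsOrientedCap X F c v n := by
  rintro ⟨-, -, -, hle, -⟩
  have hρ1 : (1 : ℝ) ≤ ρ := by linarith
  have hρ2' : (0 : ℝ) ≤ ρ - 2 := by linarith
  obtain ⟨w₁, hw₁, w₂, -, w₃, -, -, -, -, hn1, -, -⟩ := exists_three_far_slots A hn hmenu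
  have hflip := inner_twin_eq_neg A F hn hF w₁
  have hneg : ⟪F w₁, n⟫_ℝ = -Real.sqrt (2 / 3) := by rw [hflip, hn1]
  have hr : 0 < Real.sqrt (2 / 3) := Real.sqrt_pos.2 (by norm_num)
  have hocc : c + F w₁ ∈ X := hle w₁ hw₁ (by rw [hneg]; linarith)
  have hFw : ‖F w₁‖ = 1 := by rw [LinearIsometryEquiv.norm_map, norm_eq_one_of_mem_fccSlots hw₁]
  have hq2 : a ≤ (c + F w₁) 2 := by
    have h1 := abs_apply_sub_le_dist (c + F w₁) c 2
    rw [dist_eq_norm, add_sub_cancel_left, hFw] at h1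
    linarith [(abs_le.1 h1).1]
  have hqr : (c + F w₁) 0 ^ 2 + (c + F w₁) 1 ^ 2 ≤ (ρ - 1) ^ 2 := by
    have := lateral_sq_add_le c (F w₁) hρ2' hcr
    rw [hFw] at this
    convert this using 2; ring
  have hqP := mem_sample_of_sealed A t a b ρ hρ1 hab hX hPX hP hocc hq2 (hceil _ hocc) hqr
  have hqΛ := ((hP _).1 hqP).1
  have hFwΛ : F w₁ ∈ A '' fccStacking 1 (Real.sqrt (2 / 3)) := by
    have := sub_mem_image_of_mem_affine A t (c + F w₁) c hqΛ hcΛ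
    rwa [add_sub_cancel_left] at this
  exact twin_negative_slot_not_mem_image A F hn hF hw₁ hneg hFwΛ

end Summit.Ventures.Crystal3D.Theorems

end
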